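import Summits.PneNP.PneNP.Theorems.ChebyshevTracialDesignExtendedSign
import Summits.PneNP.PneNP.Theorems.ChebyshevTracialDesignAdaptedLowDegree
import Summits.PneNP.PneNP.Theorems.ChebyshevTracialDesignHSModeParseval
import Summits.PneNP.PneNP.Theorems.ChebyshevTracialDesignVirtualValueUnique
import Summits.PneNP.PneNP.Theorems.ChebyshevTracialDesignWhiteningData
import Summits.PneNP.PneNP.Theorems.ChebyshevTracialDesignTightFreeSpectral
import HarnessLib

/-!
# Cell pnp-psdrank, route `ChebyshevTracialDesign`: the DIRECTIONAL SIGN cell at all Gram degrees ≤ c'/2 — if, for each perfect matching `M`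
# separately, the compression `P_M X_U P_M` of a contraction field to the range of the test projection is a Gram field of Johnson degree `≤ k`
# in `U` (`2k ≤ c'`), then `Σ W·tr(X_U P_M) ≤ r·(B_v√P_D + 2^{2k+1}√P_{2k} + Σ_{D/2<κ≤k} R_κ√A_κ)` (crux `TracialDecayExp20`, stmt-PneNP-19878)

Brick 90b (prover g17; MEMO-20 §1(d)/§2). Brick 88b (`…AdaptedLowDegree.sum_levelWeight_trace_proj_nonpos_of_rangeLowDegree`) is the directional
SIGN criterion at Gram degree `≤ D/2` (exactness); brick 90 (`…ExtendedSign.value_le_of_lowDegree_allModes`) lifts the plain SIGN cell to all Gram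
degrees `≤ c'/2` by reading the virtual value at the Gram cutoff (extrapolation stability, brick 89 §1) and crossing the gap to the design degree
harmonically (bricks 45b/45d/22a). This file combines the two: the pair `(X, P)` — `X` a FIXED contraction field, `P_M` idempotent psd contractions —
is fed to brick 20 at cutoff `2k` and to bricks 45b/45d/22a exactly as in brick 90, while the exact per-matching level law (Step 1) uses the
M-DEPENDENT Gram representation `P_M X_U P_M = A^{(M)}_U (A^{(M)}_U)ᵀ` through `tr(X_U P_M) = tr(P_M X_U P_M)` and `lowdeg_sum_law` with `Y = 1`.
Main theorem **`value_proj_le_of_rangeLowDegree_allModes`**. In the one-sided form of the crux (brick 86: `Y_M = P_M` the positive spectral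
projection of the virtual average) this is the by-name statement «a cut field that is a low-degree (≤ c'/2) Gram field IN THE DIRECTIONS EACH
MATCHING TESTS is priced at brick 20's tail, r-uniformly» — the SIGN block of a matching-dependent decomposition (brick 88's price list).
[cite: Grigoriev2001, Lemma 1.4 (PDF p. 8)] [cite: Rothvoss2017, §2 (PDF p. 6)] [cite: GriblingDelaatLaurent2019, §5]
[cite: BrouwerHaemers2012, Thm. 4.9.1 (PDF p. 93)] [cite: CoppersmithRivlin1992, Thm. (p. 970)]
Stature: support/instrument (kernel lane, no defs, axioms standard). WHAT THIS IS NOT: no decomposition theorem, no proof or refutation of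
`TracialDecayExp20`, nothing on psd rank of P_PM(K_n), no P-vs-NP content. Supports stmt-PneNP-19878.
-/

set_option linter.dupNamespace false -- `Summit.PneNP.PneNP.…`: summit = sub-problem (D-0017)

noncomputable section

namespace Summit.PneNP.PneNP.Theorems.ChebyshevTracialDesignExtendedSignDirectional

open Finset Matrix Polynomial Literature.Barriers.PneNP Literature.Combinatorics.SimpleGraph.CycleSpace
open Literature.Computability.Complexity Literature.Combinatorics.Optimization
open Literature.Combinatorics.AssociationSchemes Literature.Combinatorics.AssociationSchemes.JohnsonHarmonics
open Literature.Combinatorics.AssociationSchemes.JohnsonSpectrum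
open Summit.PneNP.PneNP.Theorems.ChebyshevTracialDesignJunta
open Summit.PneNP.PneNP.Theorems.ChebyshevTracialDesignTracialProfilePolynomial
open Summit.PneNP.PneNP.Theorems.ChebyshevTracialDesignProfileExtrapolation (value_eq_level_sums)
open Summit.PneNP.PneNP.Theorems.ChebyshevTracialDesignProfilePolynomial (card_pmatch_pos)
open Summit.PneNP.PneNP.Theorems.ChebyshevTracialDesignExtrapolatedSign (abs_eval_zero_le_two_pow_mul)
open Summit.PneNP.PneNP.Theorems.ChebyshevTracialDesignExtendedSign (sum_trace_cuts_le sum_trace_matchings_le)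
open Summit.PneNP.PneNP.Theorems.ChebyshevTracialDesignAdaptedLowDegree (trace_mul_proj_eq)
open Summit.PneNP.PneNP.Theorems.ChebyshevTracialDesignVirtualBimodePsd (virtual_psd_mul_eq)
open Summit.PneNP.PneNP.Theorems.ChebyshevTracialDesignHSModeParseval (HSmode_sq_le_traces)
open Summit.PneNP.PneNP.Theorems.ChebyshevTracialDesignVirtualValueUnique (tracial_value_truncation_of_data)
open Summit.PneNP.PneNP.Theorems.ChebyshevTracialDesignWhiteningData (layerRatio_nonneg)
open Summit.PneNP.PneNP.Theorems.ChebyshevTracialDesignTightFreeSpectral (exists_tightGram_classFunction)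
open Summit.PneNP.PneNP.Theorems.ChebyshevTracialDesignAPrioriBounds (trace_le_of_sub_posSemidef)
open scoped MatrixOrder

variable {n : ℕ}

/-- **THE DIRECTIONAL SIGN CELL AT ALL GRAM DEGREES `k ≤ c'/2`, r-UNIFORM.** For `n` even, an exact design `(n, t = 2c'+1, T, D, B_v, C, w)` with
`D ≤ 2c'`, `D ≤ 2k`, `2k ≤ c'`; a contraction field `X` on the odd cuts; idempotent psd contractions `P_M` on the perfect matchings; and, for every
`M`, a Gram representation `P_M X_U P_M = A^{(M)}_U (A^{(M)}_U)ᵀ` with `A^{(M)}` of Johnson degree `≤ k` in `U`: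
`Σ_{U,M} levelWeight(U,M)·tr(X_U P_M) ≤ r·(B_v·√P_D + 2^{2k+1}·√P_{2k} + Σ_{κ ∈ (D/2, k]} R_κ·√A_κ)`.
[cite: Grigoriev2001, Lemma 1.4 (PDF p. 8)] [cite: Rothvoss2017, §2 (PDF p. 6)] [cite: GriblingDelaatLaurent2019, §5]
[cite: BrouwerHaemers2012, Thm. 4.9.1 (PDF p. 93)] [cite: CoppersmithRivlin1992, Thm. (p. 970)] -/
theorem value_proj_le_of_rangeLowDegree_allModes {c' T D : ℕ} {Bv : ℝ} {C : Finset ℕ} {w : ℕ → ℝ} (hn : Even n)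
    (hdes : IsExactDesign n (2 * c' + 1) T D Bv C w) (hD : D ≤ 2 * c') {r m k : ℕ} (hDk : D ≤ 2 * k) (hkc : 2 * k ≤ c')
    (X : OddSet n → Matrix (Fin r) (Fin r) ℝ) (hX : ∀ U, (X U).PosSemidef ∧ (1 - X U).PosSemidef)
    (P : PMatch n → Matrix (Fin r) (Fin r) ℝ) (hP2 : ∀ M, P M * P M = P M) (hY : ∀ M, (P M).PosSemidef ∧ (1 - P M).PosSemidef)
    (A : PMatch n → OddSet n → Matrix (Fin r) (Fin m) ℝ) (hA : ∀ M, IsLowDegreeU n k (A M))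
    (hXP : ∀ M U, P M * X U * P M = A M U * (A M U)ᵀ) :
    ∑ U, ∑ M, levelWeight n (2 * c' + 1) C w U M * (X U * P M).trace ≤
      (r : ℝ) * (Bv * Real.sqrt (∏ i ∈ range (D / 2 + 1), ((2 * i + 1 : ℝ) / ((n : ℝ) - 2 * i))) +
        2 ^ (2 * k + 1) * Real.sqrt (∏ i ∈ range (k + 1), ((2 * i + 1 : ℝ) / ((n : ℝ) - 2 * i))) +
        ∑ κ ∈ Ico (D / 2 + 1) (k + 1),
          (∏ i ∈ range κ, (((2 * c' + 1 : ℝ) - 2 * i) * ((n : ℝ) - 2 * c' - 1 - 2 * i) /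
              (((2 * c' : ℝ) - 2 * i) * ((n : ℝ) - 2 * c' - 2 - 2 * i)))) *
            Real.sqrt (∏ i ∈ range κ, ((2 * i + 1 : ℝ) / ((n : ℝ) - 2 * i)))) := by
  classical
  have hG : Grigoriev2001_knapsackFormNonneg := Grigoriev2001_knapsackFormNonneg_holds
  have hdes' := hdes
  obtain ⟨htodd, htn, hTt, hC, -, hexact, hBv⟩ := hdes
  have ht : 2 * (2 * c' + 1) ≤ n := by omega
  have h4k : 4 * k ≤ 2 * c' + 1 := by omega
  -- constants
  have hPm : (0 : ℝ) < Fintype.card (PMatch n) := by exact_mod_cast card_pmatch_pos hn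
  have hCn : (0 : ℝ) < (n.choose (2 * c' + 1) : ℝ) := by exact_mod_cast Nat.choose_pos (by omega)
  set Pm : ℝ := (Fintype.card (PMatch n) : ℝ) with hPmdef
  set Cn : ℝ := (n.choose (2 * c' + 1) : ℝ) with hCndef
  set N₁ : ℝ := ((((n / 2).choose (1 + c') * (1 + c').choose c' * 2 ^ 1 : ℕ) : ℝ)) with hN₁
  have hN₁pos : 0 < N₁ := by
    rw [hN₁]
    have h1 : 0 < (n / 2).choose (1 + c') := Nat.choose_pos (by omega)
    have h2 : 0 < (1 + c').choose c' := Nat.choose_pos (by omega)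
    exact_mod_cast Nat.mul_pos (Nat.mul_pos h1 h2) (by norm_num)
  set Aκ : ℕ → ℝ := fun κ => ∏ i ∈ range κ, ((2 * i + 1 : ℝ) / ((n : ℝ) - 2 * i)) with hAκ
  set R : ℕ → ℝ := fun κ => ∏ i ∈ range κ, (((2 * c' + 1 : ℝ) - 2 * i) * ((n : ℝ) - 2 * c' - 1 - 2 * i) /
    (((2 * c' : ℝ) - 2 * i) * ((n : ℝ) - 2 * c' - 2 - 2 * i))) with hR
  have hAκ0 : ∀ κ, κ ≤ c' → 0 ≤ Aκ κ := fun κ hκ => by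
    rw [hAκ]
    refine prod_nonneg fun i hi => ?_
    have hi' := mem_range.1 hi
    have : (2 * i : ℝ) + 2 ≤ n := by exact_mod_cast (show 2 * i + 2 ≤ n by omega)
    exact div_nonneg (by positivity) (by linarith)
  -- coefficients of the low-degree entries
  have hα' : ∀ M a j, ∃ c : {A' : Finset (Fin n) // A'.card ≤ k} → ℝ,
      ∑ A', c A' • (fun U : OddSet n => if A'.1 ⊆ U.1 then (1 : ℝ) else 0) = fun U => A M U a j :=
    fun M a j => (Submodule.mem_span_range_iff_exists_fun ℝ).1 (hA M a j)
  choose α hα using hα'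
  have hAeval : ∀ (M : PMatch n) (U : OddSet n) a j,
      A M U a j = ∑ A' : {A' : Finset (Fin n) // A'.card ≤ k}, α M a j A' * (if A'.1 ⊆ U.1 then (1 : ℝ) else 0) := by
    intro M U a j
    have := congrFun (hα M a j) U
    rw [Finset.sum_apply] at this
    rw [← this]
    exact sum_congr rfl fun A' _ => by rw [Pi.smul_apply, smul_eq_mul]
  -- the compressed trace, per matching
  have htrP : ∀ (M : PMatch n) (U : OddSet n), (X U * P M).trace = (A M U * (A M U)ᵀ * (1 : Matrix (Fin r) (Fin r) ℝ)).trace :=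
    fun M U => by rw [trace_mul_proj_eq (X U) (P M) (hP2 M), hXP M U, Matrix.mul_one]
  -- Step 1: per matching, the exact polynomial level law of degree ≤ 2k with nonnegative virtual value
  have hN : ∀ M : PMatch n, M.1.card = n / 2 := fun M => by have := two_mul_card_pmatch M; omega
  have hP : ∀ M : PMatch n, ∃ Q : Polynomial ℝ, Q.natDegree ≤ 2 * k ∧ 0 ≤ Q.eval 0 ∧ ∀ c i : ℕ, c + 2 * i = (2 * c' + 1) →
      ∑ U : OddSet n, (if U.1.card = (2 * c' + 1) ∧ cc U M = c then (X U * P M).trace else 0) =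
        (((n / 2).choose (c + i) * (c + i).choose i * 2 ^ c : ℕ) : ℝ) * Q.eval (c : ℝ) := by
    intro M
    have hMt : (2 * c' + 1) + 1 ≤ M.1.card := by have := two_mul_card_pmatch M; omega
    have hk2 : 2 * k ≤ M.1.card := by omega
    have hr₁ : (k : ℝ) - 1 < ((2 * c' + 1 : ℕ) : ℝ) / 2 := by
      have : (4 : ℝ) * k ≤ ((2 * c' + 1 : ℕ) : ℝ) := by exact_mod_cast h4k
      linarith
    have hr₂ : ((2 * c' + 1 : ℕ) : ℝ) / 2 < (M.1.card : ℝ) - k + 1 := by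
      have h1 : (4 : ℝ) * k ≤ ((2 * c' + 1 : ℕ) : ℝ) := by exact_mod_cast h4k
      have h2 : ((2 * c' + 1 : ℕ) : ℝ) + 1 ≤ M.1.card := by exact_mod_cast hMt
      linarith
    obtain ⟨Q, hQdeg, hQ0, hQval⟩ := lowdeg_sum_law hG M hk2 hr₁ hr₂ (α M) (1 : Matrix (Fin r) (Fin r) ℝ) Matrix.PosSemidef.one
    refine ⟨Q, hQdeg, hQ0, fun c i hci => ?_⟩
    have hre : ∑ U : OddSet n, (if U.1.card = (2 * c' + 1) ∧ cc U M = c then (X U * P M).trace else 0) =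
        ∑ U : OddSet n, (if U.1.card = (2 * c' + 1) ∧ cc U M = c then
          ((fun U : OddSet n => A M U * (A M U)ᵀ) U * (fun _ : PMatch n => (1 : Matrix (Fin r) (Fin r) ℝ)) M).trace else 0) :=
      sum_congr rfl fun U _ => by rw [htrP M U]
    rw [hre, sum_oddSet_level_eq M hci (fun U => A M U * (A M U)ᵀ) (fun _ => (1 : Matrix (Fin r) (Fin r) ℝ)), ← hN M, ← hQval c i hci]
    refine sum_congr rfl fun U' hU' => ?_
    have hodd : Odd U'.card := by
      obtain ⟨-, hc, hi⟩ := mem_filter.1 hU'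
      have h := card_eq_cr_add_two_mul_in M.2 (subset_univ U')
      rw [hc, hi, hci] at h
      exact h ▸ htodd
    rw [dif_pos hodd]
    show (A M ⟨U', hodd⟩ * (A M ⟨U', hodd⟩)ᵀ * (1 : Matrix (Fin r) (Fin r) ℝ)).trace = _
    rw [trace_mul_transpose_mul_eq]
    refine sum_congr rfl fun j _ => sum_congr rfl fun a _ => sum_congr rfl fun b _ => ?_
    rw [hAeval M ⟨U', hodd⟩ a j, hAeval M ⟨U', hodd⟩ b j]
  choose Q hQdeg hQ0 hQval using hP
  -- Step 2: the size of the level classes `|Q_c((2 * c' + 1))| = |PM|·T(n/2; c, i)`, positive at every odd level `c ≤ (2 * c' + 1)`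
  have hQ : ∀ c i : ℕ, c + 2 * i = (2 * c' + 1) → ((Qset n (2 * c' + 1) c).card : ℝ) =
      Pm * (((n / 2).choose (c + i) * (c + i).choose i * 2 ^ c : ℕ) : ℝ) := by
    intro c i hci
    have e1 : ((Qset n (2 * c' + 1) c).card : ℝ) =
        ∑ M : PMatch n, ∑ U : OddSet n, (if U.1.card = (2 * c' + 1) ∧ cc U M = c then (1 : ℝ) else 0) := by
      rw [Qset, Finset.card_filter, Nat.cast_sum, Fintype.sum_prod_type, sum_comm]
      refine sum_congr rfl fun M _ => sum_congr rfl fun U _ => ?_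
      split_ifs <;> simp
    have e2 : ∀ M : PMatch n, ∑ U : OddSet n, (if U.1.card = (2 * c' + 1) ∧ cc U M = c then (1 : ℝ) else 0) =
        (((n / 2).choose (c + i) * (c + i).choose i * 2 ^ c : ℕ) : ℝ) := by
      intro M
      have key := sum_oddSet_level_eq M hci (r := 1) (fun _ => 1) (fun _ => 1)
      simp only [Matrix.mul_one, trace_one, Fintype.card_fin, Nat.cast_one, dite_eq_ite] at key
      rw [key]
      have hodd : ∀ U' ∈ (univ : Finset (Fin n)).powerset.filter (fun U' =>
          (M.1.filter fun e => cutCount U' e = 1).card = c ∧ (M.1.filter fun e => cutCount U' e = 2).card = i),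
          (if Odd U'.card then (1 : ℝ) else 0) = 1 := by
        intro U' hU'
        rw [mem_filter] at hU'
        have hc := card_eq_cr_add_two_mul_in M.2 (subset_univ U')
        rw [hU'.2.1, hU'.2.2, hci] at hc
        rw [if_pos (hc ▸ htodd)]
      rw [sum_congr rfl hodd, sum_const, nsmul_eq_mul, mul_one, card_filter_cr_in_eq M.2, hN M]
    rw [e1, Fintype.sum_congr _ _ e2, sum_const, card_univ, nsmul_eq_mul]
  have hTpos : ∀ c i : ℕ, c + 2 * i = (2 * c' + 1) → (0 : ℝ) < (((n / 2).choose (c + i) * (c + i).choose i * 2 ^ c : ℕ) : ℝ) := by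
    intro c i hci
    have h1 : c + i ≤ n / 2 := by omega
    have := Nat.choose_pos h1
    have := Nat.choose_pos (show i ≤ c + i by omega)
    positivity
  -- the averaged exact polynomial `P♯`
  set Psharp : Polynomial ℝ := Polynomial.C (Pm⁻¹) * ∑ M : PMatch n, Q M with hPsharp
  have hPsharp_deg : Psharp.natDegree ≤ 2 * k := by
    refine (natDegree_C_mul_le _ _).trans ?_
    exact Polynomial.natDegree_sum_le_of_forall_le _ _ fun M _ => hQdeg M
  have hPsharp_eval : ∀ x : ℝ, Psharp.eval x = Pm⁻¹ * ∑ M : PMatch n, (Q M).eval x := fun x => by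
    rw [hPsharp, eval_mul, eval_C, eval_finsetSum]
  have hPsharp0 : 0 ≤ Psharp.eval 0 := by
    rw [hPsharp_eval]
    exact mul_nonneg (inv_nonneg.2 hPm.le) (sum_nonneg fun M _ => hQ0 M)
  set Φ : ℕ → ℝ := fun c => ∑ q ∈ Qset n (2 * c' + 1) c, (X q.1 * P q.2).trace with hΦ
  have hΦlaw : ∀ mm : ℕ, mm ≤ c' → Φ (2 * mm + 1) = ((Qset n (2 * c' + 1) (2 * mm + 1)).card : ℝ) * Psharp.eval ((2 * mm + 1 : ℕ) : ℝ) := by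
    intro mm hmm
    have hci : (2 * mm + 1) + 2 * (c' - mm) = (2 * c' + 1) := by omega
    rw [hΦ]; simp only
    rw [← level_sum_eq_sum_Qset (2 * c' + 1) (2 * mm + 1) (fun U M => (X U * P M).trace),
      sum_congr rfl fun M _ => hQval M (2 * mm + 1) (c' - mm) hci, ← mul_sum, hQ _ _ hci, hPsharp_eval]
    field_simp
  -- Step 3: brick 20 at the Gram cutoff `2k`: harmonic data `p` and the degree-2k profile polynomial `PK` with `PK(0) = VV_{2k}(p)/|PM|`
  obtain ⟨p, PK, hp, hpdec, hPKdeg, hPK0, hlevK⟩ :=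
    tracial_profile_polynomial_of_contractions hn htn (show 2 * k ≤ 2 * c' by omega) X P hX hY
  set τK : ℝ := (r : ℝ) * Real.sqrt (∏ i ∈ range (2 * k / 2 + 1), ((2 * i + 1 : ℝ) / ((n : ℝ) - 2 * i))) with hτK
  have hτK0 : 0 ≤ τK := mul_nonneg (Nat.cast_nonneg r) (Real.sqrt_nonneg _)
  have hcloseK : ∀ mm : ℕ, mm ≤ c' → |Psharp.eval ((2 * mm + 1 : ℕ) : ℝ) - PK.eval ((2 * mm + 1 : ℕ) : ℝ)| ≤ τK := by
    intro mm hmm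
    have hci : (2 * mm + 1) + 2 * (c' - mm) = (2 * c' + 1) := by omega
    have hQpos : (0 : ℝ) < ((Qset n (2 * c' + 1) (2 * mm + 1)).card : ℝ) := by
      rw [hQ _ _ hci]; exact mul_pos hPm (hTpos _ _ hci)
    have h1 := hlevK mm hmm
    have h2 : ∑ q ∈ Qset n (2 * c' + 1) (2 * mm + 1), (X q.1 * P q.2).trace = Φ (2 * mm + 1) := rfl
    rw [h2, hΦlaw mm hmm, ← mul_sub, abs_mul, Nat.abs_cast] at h1
    exact le_of_mul_le_mul_left h1 hQpos
  -- virtual nonnegativity at cutoff 2k, up to the extrapolated tail: `PK(0) ≥ −2^{2k+1} τK`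
  have hPK0_lb : -(2 ^ (2 * k + 1) * τK) ≤ PK.eval 0 := by
    set Δ : Polynomial ℝ := Psharp - PK with hΔ
    have hΔdeg : Δ.natDegree ≤ 2 * k := (natDegree_sub_le _ _).trans (max_le hPsharp_deg hPKdeg)
    have hΔ0 : |Δ.eval 0| ≤ 2 ^ (2 * k + 1) * τK := by
      refine abs_eval_zero_le_two_pow_mul (2 * k) Δ hΔdeg hτK0 fun j hj => ?_
      have h := hcloseK j (by omega)
      rw [hΔ, eval_sub]
      push_cast at h ⊢
      exact h
    have h1 := (abs_le.1 hΔ0).2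
    rw [hΔ, eval_sub] at h1
    linarith
  -- the virtual values at the two cutoffs, in bi-mode form (brick 45b)
  set k₁ : Finset (Fin n) → PMatch n → ℝ := fun U M => if (U.filter fun x => M.2.partner x ∉ U).card = 1 then (1 : ℝ) else 0 with hk₁
  set Cm : ℕ → ℝ := fun κ => ∑ ab : Fin r × Fin r, ∑ M : PMatch n, P M ab.2 ab.1 * ∑ U ∈ univ.powersetCard (2 * c' + 1),
    (up^[2 * c' + 1 - 2 * κ] (p ab (2 * κ))) U * k₁ U M with hCm
  set VK : ℝ := ∑ M : PMatch n, ∑ A' : {A' : Finset (Fin n) // A'.card ≤ 2 * k},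
        (Matrix.of (fun a b : Fin r =>
          (∑ j ∈ range (2 * c' + 1 + 1), ((2 * c' + 1 - j).factorial : ℝ) • (if 2 * k < j then 0 else p (a, b) j)) A'.1) * P M).trace *
          knapsackMoment M.1.card (((2 * c' + 1 : ℕ) : ℝ) / 2) (M.1.filter fun e => ∃ a ∈ A'.1, a ∈ e).card with hVK
  set VD : ℝ := ∑ M : PMatch n, ∑ A' : {A' : Finset (Fin n) // A'.card ≤ D},
        (Matrix.of (fun a b : Fin r =>
          (∑ j ∈ range (2 * c' + 1 + 1), ((2 * c' + 1 - j).factorial : ℝ) • (if D < j then 0 else p (a, b) j)) A'.1) * P M).trace *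
          knapsackMoment M.1.card (((2 * c' + 1 : ℕ) : ℝ) / 2) (M.1.filter fun e => ∃ a ∈ A'.1, a ∈ e).card with hVD
  have h45K : VK * N₁ = ∑ κ ∈ range (2 * k / 2 + 1), R κ * Cm κ := virtual_psd_mul_eq hn ht (show 2 * k ≤ 2 * c' by omega) p hp P
  have h45D : VD * N₁ = ∑ κ ∈ range (D / 2 + 1), R κ * Cm κ := virtual_psd_mul_eq hn ht hD p hp P
  have hk2 : 2 * k / 2 = k := by omega
  rw [hk2] at h45K hτK
  -- `VK = Pm · PK(0)`
  have hVK_eq : VK = Pm * PK.eval 0 := by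
    rw [hPK0, ← mul_assoc, mul_inv_cancel₀ hPm.ne', one_mul]
  -- Step 4: the modes between the two cutoffs (brick 45d)
  obtain ⟨κ₁, hA1⟩ := exists_tightGram_classFunction (n := n) (odd_two_mul_add_one c')
  have hXtr := sum_trace_cuts_le (c' := c') hX
  have hYtr := sum_trace_matchings_le hY
  have hmode : ∀ κ, κ ≤ c' → |Cm κ| ≤ (r : ℝ) * Pm * N₁ * Real.sqrt (Aκ κ) := by
    intro κ hκ
    have hsq := HSmode_sq_le_traces hn ht hκ X P hX hY p hp hpdec κ₁ hA1
    have hbound : (∑ M : PMatch n, (P M).trace) * (∑ U ∈ univ.filter (fun U : OddSet n => U.1.card = 2 * c' + 1), (X U).trace) *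
        (Pm * N₁ ^ 2 / Cn * Aκ κ) ≤ ((r : ℝ) * Pm * N₁ * Real.sqrt (Aκ κ)) ^ 2 := by
      have hYtr0 : 0 ≤ ∑ M : PMatch n, (P M).trace := sum_nonneg fun M _ => (hY M).1.trace_nonneg
      have hXtr0 : 0 ≤ ∑ U ∈ univ.filter (fun U : OddSet n => U.1.card = 2 * c' + 1), (X U).trace :=
        sum_nonneg fun U _ => (hX U).1.trace_nonneg
      have hc0 : 0 ≤ Pm * N₁ ^ 2 / Cn * Aκ κ := mul_nonneg (div_nonneg (mul_nonneg hPm.le (sq_nonneg _)) hCn.le) (hAκ0 κ hκ)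
      calc (∑ M : PMatch n, (P M).trace) * (∑ U ∈ univ.filter (fun U : OddSet n => U.1.card = 2 * c' + 1), (X U).trace) *
            (Pm * N₁ ^ 2 / Cn * Aκ κ)
          ≤ ((r : ℝ) * Pm) * ((r : ℝ) * Cn) * (Pm * N₁ ^ 2 / Cn * Aκ κ) := by
            exact mul_le_mul_of_nonneg_right (mul_le_mul hYtr hXtr hXtr0 (mul_nonneg (Nat.cast_nonneg r) hPm.le)) hc0
        _ = (r : ℝ) ^ 2 * Pm ^ 2 * N₁ ^ 2 * Aκ κ * (Cn * Cn⁻¹) := by ring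
        _ = (r : ℝ) ^ 2 * Pm ^ 2 * N₁ ^ 2 * Aκ κ := by rw [mul_inv_cancel₀ hCn.ne', mul_one]
        _ = ((r : ℝ) * Pm * N₁ * Real.sqrt (Aκ κ)) ^ 2 := by
            rw [show ((r : ℝ) * Pm * N₁ * Real.sqrt (Aκ κ)) ^ 2 = (r : ℝ) ^ 2 * Pm ^ 2 * N₁ ^ 2 * (Real.sqrt (Aκ κ)) ^ 2 by ring,
              Real.sq_sqrt (hAκ0 κ hκ)]
    have h2 : (Cm κ) ^ 2 ≤ ((r : ℝ) * Pm * N₁ * Real.sqrt (Aκ κ)) ^ 2 := hsq.trans hbound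
    have h3 : 0 ≤ (r : ℝ) * Pm * N₁ * Real.sqrt (Aκ κ) :=
      mul_nonneg (mul_nonneg (mul_nonneg (Nat.cast_nonneg r) hPm.le) hN₁pos.le) (Real.sqrt_nonneg _)
    exact abs_le.2 (abs_le_of_sq_le_sq' h2 h3)
  have hmid : |∑ κ ∈ Ico (D / 2 + 1) (k + 1), R κ * Cm κ| ≤
      (r : ℝ) * Pm * N₁ * ∑ κ ∈ Ico (D / 2 + 1) (k + 1), R κ * Real.sqrt (Aκ κ) := by
    calc |∑ κ ∈ Ico (D / 2 + 1) (k + 1), R κ * Cm κ| ≤ ∑ κ ∈ Ico (D / 2 + 1) (k + 1), |R κ * Cm κ| := abs_sum_le_sum_abs _ _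
      _ ≤ ∑ κ ∈ Ico (D / 2 + 1) (k + 1), R κ * ((r : ℝ) * Pm * N₁ * Real.sqrt (Aκ κ)) := by
          refine sum_le_sum fun κ hκ => ?_
          have hκc : κ ≤ c' := by have := (mem_Ico.1 hκ).2; omega
          rw [abs_mul, abs_of_nonneg (layerRatio_nonneg ht hκc)]
          exact mul_le_mul_of_nonneg_left (hmode κ hκc) (layerRatio_nonneg ht hκc)
      _ = (r : ℝ) * Pm * N₁ * ∑ κ ∈ Ico (D / 2 + 1) (k + 1), R κ * Real.sqrt (Aκ κ) := by
          rw [mul_sum]; exact sum_congr rfl fun κ _ => by ring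
  -- `VD·N₁ = VK·N₁ − (middle modes)`
  have hsplit : VD * N₁ = VK * N₁ - ∑ κ ∈ Ico (D / 2 + 1) (k + 1), R κ * Cm κ := by
    rw [h45D, h45K, ← sum_range_add_sum_Ico _ (show D / 2 + 1 ≤ k + 1 by omega)]
    ring
  -- hence a lower bound on `VD / Pm`
  have hVD_lb : -(2 ^ (2 * k + 1) * τK) - (r : ℝ) * ∑ κ ∈ Ico (D / 2 + 1) (k + 1), R κ * Real.sqrt (Aκ κ) ≤ Pm⁻¹ * VD := by
    have h1 : Pm * N₁ * (-(2 ^ (2 * k + 1) * τK)) ≤ VK * N₁ := by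
      rw [hVK_eq]
      have := mul_le_mul_of_nonneg_left hPK0_lb (mul_pos hPm hN₁pos).le
      linarith [this]
    have h2 := (abs_le.1 hmid).2
    have h3 : Pm * N₁ * (-(2 ^ (2 * k + 1) * τK) - (r : ℝ) * ∑ κ ∈ Ico (D / 2 + 1) (k + 1), R κ * Real.sqrt (Aκ κ)) ≤ VD * N₁ := by
      rw [hsplit]; nlinarith [h1, h2]
    have h4 : (-(2 ^ (2 * k + 1) * τK) - (r : ℝ) * ∑ κ ∈ Ico (D / 2 + 1) (k + 1), R κ * Real.sqrt (Aκ κ)) * (Pm * N₁) ≤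
        (Pm⁻¹ * VD) * (Pm * N₁) := by
      calc _ = Pm * N₁ * (-(2 ^ (2 * k + 1) * τK) - (r : ℝ) * ∑ κ ∈ Ico (D / 2 + 1) (k + 1), R κ * Real.sqrt (Aκ κ)) := by ring
        _ ≤ VD * N₁ := h3
        _ = (Pm⁻¹ * VD) * (Pm * N₁) := by field_simp
    exact le_of_mul_le_mul_right h4 (mul_pos hPm hN₁pos)
  -- Step 5: the design value is `−VD/Pm` up to the degree-D tail (brick 20 / 22a for the datum `p`)
  have htrunc := tracial_value_truncation_of_data hn hdes' hD X P p hp hpdec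
  have hPD := Summit.PneNP.PneNP.Theorems.ChebyshevTracialDesignProfilePolynomial.prod_atten_nonneg (n := n) (K := D) (by omega)
  have htail := sqrt_tail_le_of_le hPD hCn hPm (Nat.cast_nonneg r)
    (sum_nonneg fun M _ => by positivity) (sum_frobenius_cuts_le ⟨c', rfl⟩ hX) (sum_frobenius_matchings_le hY)
  have hBv0 : 0 ≤ ∑ c ∈ C, |w c| := sum_nonneg fun c _ => abs_nonneg _
  have hval_le : ∑ U, ∑ M, levelWeight n (2 * c' + 1) C w U M * (X U * P M).trace ≤
      -(Pm⁻¹ * VD) + Bv * ((r : ℝ) * Real.sqrt (∏ i ∈ range (D / 2 + 1), ((2 * i + 1 : ℝ) / ((n : ℝ) - 2 * i)))) := by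
    have h1 := (abs_le.1 htrunc).2
    have h2 : (∑ c ∈ C, |w c|) * Real.sqrt ((∏ i ∈ range (D / 2 + 1), ((2 * i + 1 : ℝ) / ((n : ℝ) - 2 * i))) *
        ((∑ U : OddSet n, if U.1.card = 2 * c' + 1 then ∑ a, ∑ b, X U a b ^ 2 else 0) / (n.choose (2 * c' + 1) : ℝ)) *
        ((∑ M : PMatch n, ∑ a, ∑ b, P M a b ^ 2) / (Fintype.card (PMatch n) : ℝ))) ≤
        Bv * ((r : ℝ) * Real.sqrt (∏ i ∈ range (D / 2 + 1), ((2 * i + 1 : ℝ) / ((n : ℝ) - 2 * i)))) :=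
      (mul_le_mul_of_nonneg_left htail hBv0).trans (mul_le_mul_of_nonneg_right hBv (mul_nonneg (Nat.cast_nonneg r) (Real.sqrt_nonneg _)))
    linarith
  -- assemble
  have hsum0 : 0 ≤ ∑ κ ∈ Ico (D / 2 + 1) (k + 1), R κ * Real.sqrt (Aκ κ) :=
    sum_nonneg fun κ hκ => mul_nonneg (layerRatio_nonneg ht (by have := (mem_Ico.1 hκ).2; omega)) (Real.sqrt_nonneg _)
  have hfinal : ∑ U, ∑ M, levelWeight n (2 * c' + 1) C w U M * (X U * P M).trace ≤
      (r : ℝ) * (Bv * Real.sqrt (∏ i ∈ range (D / 2 + 1), ((2 * i + 1 : ℝ) / ((n : ℝ) - 2 * i))) +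
        2 ^ (2 * k + 1) * Real.sqrt (∏ i ∈ range (k + 1), ((2 * i + 1 : ℝ) / ((n : ℝ) - 2 * i))) +
        ∑ κ ∈ Ico (D / 2 + 1) (k + 1), R κ * Real.sqrt (Aκ κ)) := by
    have e : (r : ℝ) * (Bv * Real.sqrt (∏ i ∈ range (D / 2 + 1), ((2 * i + 1 : ℝ) / ((n : ℝ) - 2 * i))) +
        2 ^ (2 * k + 1) * Real.sqrt (∏ i ∈ range (k + 1), ((2 * i + 1 : ℝ) / ((n : ℝ) - 2 * i))) +
        ∑ κ ∈ Ico (D / 2 + 1) (k + 1), R κ * Real.sqrt (Aκ κ)) =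
        Bv * ((r : ℝ) * Real.sqrt (∏ i ∈ range (D / 2 + 1), ((2 * i + 1 : ℝ) / ((n : ℝ) - 2 * i)))) +
        2 ^ (2 * k + 1) * τK + (r : ℝ) * ∑ κ ∈ Ico (D / 2 + 1) (k + 1), R κ * Real.sqrt (Aκ κ) := by
      rw [hτK]; ring
    rw [e]
    linarith [hval_le, hVD_lb]
  exact hfinal

end Summit.PneNP.PneNP.Theorems.ChebyshevTracialDesignExtendedSignDirectional

end
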